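/-
COR-CM (cell pub-hodgecm2, stage 2 of the Hodge ladder) — Δ2 BRIDGE, X1 pin «J» (ASSEMBLER DECISIONS #3/#4, HOME/INBOX l.10797,
l.10813), part 2 of the rational form of the model's tower: the `U(V)(𝔸_f)`-action on `TowerQ` and the EQUIVARIANCE of the
complexification `ιT` (the field `ι_comm` of `Map43RationalData` at the pin), plus the level law that is the S3 pin field `tower_eq`.
Seat prover-pub-hodgecm2-d2bridge-prove-3-g0-0 (d2bridge-prove-3).  Port-gated (imports part 1, hence the Model cone); written blind
during the L38 hole, checked at BURST-2 END.  HC_CM is NOT proved; nothing here is a display or a pointer move.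
-/
import Summits.HodgeConjecture.CorCM.D2Bridge.TowerRationalForm
import HarnessLib

/-!
# Δ2 bridge, pin J (J1, part 2): `towerRepQ` and the equivariance of `ιT`; the level law

* §5 `translateQ g : U_K → U_{gKg⁻¹}` (rational `TowerLevel.translate`), `actQ`, `towerRepQ : Representation ℚ V.adelicFin (TowerQ … V)`
  — the field `ρU` — and **`ιT_comm : ιT ((towerRepQ g).baseChange ℂ x) = towerRep g (ιT x)`** (= `ι_comm` with `HB := Tower`,
  `ρB := towerRep`; `ιT_comm_of` is the `ℂ[U(V)(𝔸_f)]`-module spelling `of g • –`);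
* §6 **`resTotal_ιT_tmul_ofQ : resTotal Γ (ιT (z ⊗ ofQ Γ hΓ c)) = z ⊗ resQ c`** — the S3 pin field `tower_eq` with
  `transK := ιT ∘ (ofQ Γ ⊗ ℂ)`, `XK := ℂ ⊗ levelQ Γ`, `albK := refl`, `resX := resQ ⊗ ℂ`; and `towerRepQ_ofQ_of_mem` (the images of the
  rational levels are `K`-fixed).

Everything from part 1 and the tower files; no named fact; no `sorry`.
-/

noncomputable section

open scoped TensorProduct
open Function
open Literature.AlgebraicGeometry.Motives
open Literature.AlgebraicGeometry.HodgeTheory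
open Literature.NumberTheory.Automorphic
open Literature.NumberTheory.Automorphic.PicardCM
open Literature.NumberTheory.Transcendental (Arapura2012_Cor_15_4_6)
open HodgeCM HodgeCM.Model HodgeCM.Model.LevelTranslate HodgeCM.Model.TowerLevel HodgeCM.Model.TowerCarrier
open HodgeCM.Model.TowerInjective

namespace Summit.HodgeConjecture.CorCM.D2Bridge

namespace TowerRational

variable (hHD : exists_isReal_hodgeModel) (hI : hodgePQ_independent_of_hodgeModel)
  (hU : BallQuotientUniformisedDatum) (h₃ : CMAbelianVarietyRealised) (hA : Arapura2012_Cor_15_4_6)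
variable {L : CMField} {ι₁ : L →+* ℂ} {V : HermSpace3 L ι₁}


/-! ## §2b The rational level is cut out by `Rel`-invariance -/

section RelQ

variable {Γ : Level V} {hΓ : Γ.BelowConjThree}

/-- **The rational level is cut out by the same `Rel`-invariance, with the RATIONAL pull-backs**:
`c h = t_γ^* (c h')` whenever `h' ∈ (γ)_f h K`. [folklore] -/
theorem mem_levelQ_iff_rel {c : Π h : V.adelicFin, WQ hHD hI hU h₃ Γ hΓ h} :
    c ∈ levelQ hHD hI hU h₃ hA Γ hΓ ↔ ∀ (γ : ↥(Urat V)) (h h' : V.adelicFin) (r : Rel Γ γ h h'),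
      c h = trPullQ hHD hI hU h₃ hA γ (Γ.conj h hΓ) (Γ.conj h' hΓ) (transCond_of_rel hΓ r) 1 (c h') := by
  rw [mem_levelQ_iff, mem_towerLevel_iff]
  refine forall_congr' fun γ => forall_congr' fun h => forall_congr' fun h' => forall_congr' fun r => ?_
  rw [cplx_apply, cplx_apply, trPull_tmul]
  exact ⟨fun e => TensorProduct.one_tmul_injective ℚ ℂ _ e, fun e => by rw [← e]⟩

end RelQ

/-! ## §4b Elements of `U` come from one level -/

section OfQ

/-- Every element of `U` comes from some level. [folklore] -/
theorem exists_ofQ (u : TowerQ hHD hI hU h₃ hA V) :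
    ∃ (Γ : Level V) (hΓ : Γ.BelowConjThree) (c : levelQ hHD hI hU h₃ hA Γ hΓ), ofQ hHD hI hU h₃ hA Γ hΓ c = u := by
  obtain ⟨i, c, rfl⟩ := Module.DirectLimit.exists_of u
  exact ⟨i.1, i.2, c, rfl⟩

end OfQ

/-! ## §5 The action of `U(V)(𝔸_f)` on the rational tower and the equivariance of `ιT` -/

section Equivariant

/-- **`translateQ g : U_K → U_{gKg⁻¹}`**, `(g • c) h = c (h g)` read through `t_1^*` — the rational form of `TowerLevel.translate`
(pure re-indexing, no pull-back beyond `t_1`). [folklore] -/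
def translateQ {Γ : Level V} (hΓ : Γ.BelowConjThree) (g : V.adelicFin) :
    levelQ hHD hI hU h₃ hA Γ hΓ →ₗ[ℚ] levelQ hHD hI hU h₃ hA (Γ.conj g hΓ) (hΓ.conj g) where
  toFun c := ⟨fun h => trPullQ hHD hI hU h₃ hA 1 ((Γ.conj g hΓ).conj h (hΓ.conj g)) (Γ.conj (h * g) hΓ)
      (transCond_conj_conj hΓ g h) 1 ((c : Π h : V.adelicFin, WQ hHD hI hU h₃ Γ hΓ h) (h * g)), by
    rw [mem_levelQ_iff]
    have e : cplx hHD hI hU h₃ (Γ.conj g hΓ) (hΓ.conj g) (fun h => trPullQ hHD hI hU h₃ hA 1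
        ((Γ.conj g hΓ).conj h (hΓ.conj g)) (Γ.conj (h * g) hΓ) (transCond_conj_conj hΓ g h) 1
        ((c : Π h : V.adelicFin, WQ hHD hI hU h₃ Γ hΓ h) (h * g))) =
        (translate hHD hI hU h₃ hA hΓ g (inclQ hHD hI hU h₃ hA Γ hΓ c) :
          Π h : V.adelicFin, W hHD hI hU h₃ (Γ.conj g hΓ) (hΓ.conj g) h) := by
      funext h
      rw [cplx_apply, translate_apply, coe_inclQ_apply, trPull_tmul]
    rw [e]
    exact (translate hHD hI hU h₃ hA hΓ g (inclQ hHD hI hU h₃ hA Γ hΓ c)).2⟩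
  map_add' c d := by
    apply Subtype.ext
    funext h
    show trPullQ hHD hI hU h₃ hA 1 _ _ _ 1 (((c + d : levelQ hHD hI hU h₃ hA Γ hΓ) : Π h, WQ hHD hI hU h₃ Γ hΓ h) (h * g)) =
      trPullQ hHD hI hU h₃ hA 1 _ _ _ 1 ((c : Π h, WQ hHD hI hU h₃ Γ hΓ h) (h * g)) +
        trPullQ hHD hI hU h₃ hA 1 _ _ _ 1 ((d : Π h, WQ hHD hI hU h₃ Γ hΓ h) (h * g))
    rw [Submodule.coe_add, Pi.add_apply, map_add]
  map_smul' q c := by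
    apply Subtype.ext
    funext h
    show trPullQ hHD hI hU h₃ hA 1 _ _ _ 1 (((q • c : levelQ hHD hI hU h₃ hA Γ hΓ) : Π h, WQ hHD hI hU h₃ Γ hΓ h) (h * g)) =
      q • trPullQ hHD hI hU h₃ hA 1 _ _ _ 1 ((c : Π h, WQ hHD hI hU h₃ Γ hΓ h) (h * g))
    rw [Submodule.coe_smul, Pi.smul_apply, map_smul]

/-- Unfolding, componentwise. [folklore] -/
theorem coe_translateQ_apply {Γ : Level V} (hΓ : Γ.BelowConjThree) (g : V.adelicFin) (c : levelQ hHD hI hU h₃ hA Γ hΓ)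
    (h : V.adelicFin) :
    (translateQ hHD hI hU h₃ hA hΓ g c : Π h : V.adelicFin, WQ hHD hI hU h₃ (Γ.conj g hΓ) (hΓ.conj g) h) h =
      trPullQ hHD hI hU h₃ hA 1 ((Γ.conj g hΓ).conj h (hΓ.conj g)) (Γ.conj (h * g) hΓ) (transCond_conj_conj hΓ g h) 1
        ((c : Π h : V.adelicFin, WQ hHD hI hU h₃ Γ hΓ h) (h * g)) := rfl

/-- **`inclQ ∘ translateQ g = translate g ∘ inclQ`.** [folklore] -/
theorem inclQ_translateQ {Γ : Level V} (hΓ : Γ.BelowConjThree) (g : V.adelicFin) (c : levelQ hHD hI hU h₃ hA Γ hΓ) :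
    inclQ hHD hI hU h₃ hA (Γ.conj g hΓ) (hΓ.conj g) (translateQ hHD hI hU h₃ hA hΓ g c) =
      translate hHD hI hU h₃ hA hΓ g (inclQ hHD hI hU h₃ hA Γ hΓ c) := by
  apply Subtype.ext
  funext h
  rw [coe_inclQ_apply, coe_translateQ_apply, translate_apply, coe_inclQ_apply, trPull_tmul]

/-- `translateQ` commutes with the change of level (from `translate_restrictLevel`). [folklore] -/
theorem translateQ_restrictQ {Γ Γ' : Level V} (hΓ : Γ.BelowConjThree) (hle : Γ' ≤ Γ) (hΓ' : Γ'.BelowConjThree)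
    (g : V.adelicFin) (c : levelQ hHD hI hU h₃ hA Γ hΓ) :
    translateQ hHD hI hU h₃ hA hΓ' g (restrictQ hHD hI hU h₃ hA hle hΓ hΓ' c) =
      restrictQ hHD hI hU h₃ hA (Level.conj_mono hle g hΓ hΓ') (hΓ.conj g) (hΓ'.conj g)
        (translateQ hHD hI hU h₃ hA hΓ g c) :=
  inclQ_injective hHD hI hU h₃ hA (by
    rw [inclQ_translateQ, inclQ_restrictQ, inclQ_restrictQ, inclQ_translateQ, translate_restrictLevel])

variable (V)

/-- **`g ∈ U(V)(𝔸_f)` acting on the rational tower**: on `U_K`, translate to `U_{gKg⁻¹}` and map to the limit (as `TowerCarrier.act`). [folklore] -/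
def actQ (g : V.adelicFin) : TowerQ hHD hI hU h₃ hA V →ₗ[ℚ] TowerQ hHD hI hU h₃ hA V :=
  Module.DirectLimit.lift ℚ (TLvl V) (HKQ hHD hI hU h₃ hA V) (systemQ hHD hI hU h₃ hA V)
    (fun i => ofQ hHD hI hU h₃ hA (i.1.conj g i.2) (i.2.conj g) ∘ₗ translateQ hHD hI hU h₃ hA i.2 g)
    (fun i j hij c => by
      show ofQ hHD hI hU h₃ hA _ _ (translateQ hHD hI hU h₃ hA j.2 g (restrictQ hHD hI hU h₃ hA (TLvl.le_def.mp hij) i.2 j.2 c)) =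
        ofQ hHD hI hU h₃ hA _ _ (translateQ hHD hI hU h₃ hA i.2 g c)
      rw [translateQ_restrictQ, ofQ_restrictQ])

variable {V}

/-- `actQ g (ofQ Γ c) = ofQ (Γ.conj g) (translateQ g c)`. [folklore] -/
@[simp] theorem actQ_ofQ (g : V.adelicFin) {Γ : Level V} (hΓ : Γ.BelowConjThree) (c : levelQ hHD hI hU h₃ hA Γ hΓ) :
    actQ hHD hI hU h₃ hA V g (ofQ hHD hI hU h₃ hA Γ hΓ c) =
      ofQ hHD hI hU h₃ hA (Γ.conj g hΓ) (hΓ.conj g) (translateQ hHD hI hU h₃ hA hΓ g c) :=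
  Module.DirectLimit.lift_of _ _ _

/-- **`jQ ∘ actQ g = act g ∘ jQ`**: the rational action complexifies to the tower's. [folklore] -/
theorem jQ_actQ (g : V.adelicFin) (u : TowerQ hHD hI hU h₃ hA V) :
    jQ hHD hI hU h₃ hA V (actQ hHD hI hU h₃ hA V g u) = act hHD hI hU h₃ hA g (jQ hHD hI hU h₃ hA V u) := by
  obtain ⟨Γ, hΓ, c, rfl⟩ := exists_ofQ hHD hI hU h₃ hA u
  rw [actQ_ofQ, jQ_ofQ, jQ_ofQ, act_ofLevel, inclQ_translateQ]

/-- **`jQ : U → H` is injective** (`jQ u = ιT (1 ⊗ u)`, `ιT` injective, `x ↦ 1 ⊗ x` injective). [folklore] -/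
theorem jQ_injective : Injective (jQ hHD hI hU h₃ hA V) := by
  intro u v h
  apply TensorProduct.one_tmul_injective ℚ ℂ (TowerQ hHD hI hU h₃ hA V)
  apply ιT_injective hHD hI hU h₃ hA V
  show ιT hHD hI hU h₃ hA V ((1 : ℂ) ⊗ₜ[ℚ] u) = ιT hHD hI hU h₃ hA V ((1 : ℂ) ⊗ₜ[ℚ] v)
  rw [ιT_tmul, ιT_tmul, one_smul, one_smul, h]

/-- `actQ 1 = id` (through the injective `jQ`: `act 1 = id` on the tower). [folklore] -/
theorem actQ_one : actQ hHD hI hU h₃ hA V (1 : V.adelicFin) = LinearMap.id := by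
  apply LinearMap.ext
  intro u
  apply jQ_injective hHD hI hU h₃ hA
  rw [jQ_actQ, act_one, LinearMap.id_apply, LinearMap.id_apply]

/-- `actQ (g g') = actQ g ∘ actQ g'` (through the injective `jQ`: `act (g g') = act g ∘ act g'`). [folklore] -/
theorem actQ_mul (g g' : V.adelicFin) :
    actQ hHD hI hU h₃ hA V (g * g') = actQ hHD hI hU h₃ hA V g ∘ₗ actQ hHD hI hU h₃ hA V g' := by
  apply LinearMap.ext
  intro u
  apply jQ_injective hHD hI hU h₃ hA
  rw [LinearMap.comp_apply, jQ_actQ, jQ_actQ, jQ_actQ, act_mul, LinearMap.comp_apply]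

variable (V)

/-- **The rational tower as a representation of `U(V)(𝔸_{L₀,f})` over `ℚ`** — the field `ρU` of `Map43RationalData` at the pin. [folklore] -/
def towerRepQ : Representation ℚ V.adelicFin (TowerQ hHD hI hU h₃ hA V) where
  toFun := actQ hHD hI hU h₃ hA V
  map_one' := by rw [actQ_one]; rfl
  map_mul' _ _ := by rw [actQ_mul]; rfl

variable {V}

/-- Unfolding. [folklore] -/
@[simp] theorem towerRepQ_apply (g : V.adelicFin) : towerRepQ hHD hI hU h₃ hA V g = actQ hHD hI hU h₃ hA V g := rfl

/-- **`ιT` is `U(V)(𝔸_f)`-EQUIVARIANT** — the field `ι_comm` of `Map43RationalData` at the pin (`HB := Tower`, `ρB := towerRep`):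
`ιT ((ρU g ⊗ ℂ) x) = towerRep g (ιT x)`. [folklore] -/
theorem ιT_comm (g : V.adelicFin) (x : ℂ ⊗[ℚ] TowerQ hHD hI hU h₃ hA V) :
    ιT hHD hI hU h₃ hA V ((towerRepQ hHD hI hU h₃ hA V g).baseChange ℂ x) =
      towerRep hHD hI hU h₃ hA V g (ιT hHD hI hU h₃ hA V x) := by
  induction x using TensorProduct.induction_on with
  | zero => simp only [map_zero]
  | tmul z u =>
    rw [LinearMap.baseChange_tmul, ιT_tmul, ιT_tmul, towerRepQ_apply, jQ_actQ, towerRep_apply, map_smul]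
  | add s t hs ht => simp only [map_add, hs, ht]

/-- The same in the `ℂ[U(V)(𝔸_f)]`-module spelling of S₀'s `hjH` ∕ `ι_comm` (`of g • –` on `Tower`, `of_smul_eq_act`). [folklore] -/
theorem ιT_comm_of (g : V.adelicFin) (x : ℂ ⊗[ℚ] TowerQ hHD hI hU h₃ hA V) :
    ιT hHD hI hU h₃ hA V ((towerRepQ hHD hI hU h₃ hA V g).baseChange ℂ x) =
      MonoidAlgebra.of ℂ ↥V.adelicFin g • ιT hHD hI hU h₃ hA V x := by
  rw [ιT_comm, of_smul_eq_act, towerRep_apply]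

/-- S₀'s `hjH` at the pin (`jH := LinearMap.id`, `ρB := towerRep`): `towerRep g x = of g • x` on `Tower` (`of_smul_eq_act`). [folklore] -/
theorem towerRep_eq_of_smul (g : V.adelicFin) (x : Tower hHD hI hU h₃ hA V) :
    towerRep hHD hI hU h₃ hA V g x = MonoidAlgebra.of ℂ ↥V.adelicFin g • x := by
  rw [of_smul_eq_act, towerRep_apply]

end Equivariant

/-! ## §6a The rational identity-component value `resQ` -/

section ResQ

variable {Γ : Level V} {hΓ : Γ.BelowConjThree}

/-- **`resQ : U_K → H¹(P_Γ(ℂ); ℚ)`** — the rational identity-component value (`c ↦ t_1^* (c 1)` on `P_Γ`, `Γ.conj 1 = Γ`), the rational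
form of `TowerLevel.res`. [folklore] -/
def resQ (Γ : Level V) (hΓ : Γ.BelowConjThree) : levelQ hHD hI hU h₃ hA Γ hΓ →ₗ[ℚ] CohQ hHD hI hU h₃ Γ 1 where
  toFun c := trPullQ hHD hI hU h₃ hA 1 Γ (Γ.conj 1 hΓ) (transCond_one_of_eq (Level.conj_one Γ hΓ).symm) 1
    ((c : Π h : V.adelicFin, WQ hHD hI hU h₃ Γ hΓ h) 1)
  map_add' _ _ := by rw [Submodule.coe_add, Pi.add_apply, map_add]
  map_smul' _ _ := by rw [Submodule.coe_smul, Pi.smul_apply, map_smul, RingHom.id_apply]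

/-- **`res (inclQ c) = 1 ⊗ resQ c`**: the tower's identity-component restriction of a rational family is rational. [folklore] -/
theorem res_inclQ (c : levelQ hHD hI hU h₃ hA Γ hΓ) :
    TowerLevel.res hHD hI hU h₃ hA (inclQ hHD hI hU h₃ hA Γ hΓ c) = (1 : ℂ) ⊗ₜ[ℚ] resQ hHD hI hU h₃ hA Γ hΓ c := by
  rw [res_apply, coe_inclQ_apply, trPull_tmul]
  rfl

/-- `res (z • inclQ c) = z ⊗ resQ c`. [folklore] -/
theorem res_smul_inclQ (z : ℂ) (c : levelQ hHD hI hU h₃ hA Γ hΓ) :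
    TowerLevel.res hHD hI hU h₃ hA (z • inclQ hHD hI hU h₃ hA Γ hΓ c) = z ⊗ₜ[ℚ] resQ hHD hI hU h₃ hA Γ hΓ c := by
  rw [map_smul, res_inclQ, TensorProduct.smul_tmul', smul_eq_mul, mul_one]

/-- Complexified pull-backs of the universe on pure tensors: `U.pullC f k (z ⊗ x) = z ⊗ U.pull f k x`. [folklore] -/
theorem pullC_tmul {X Y : (universeOf hHD hI hU h₃).Var} (f : (universeOf hHD hI hU h₃).Mor X Y) (k : ℕ) (z : ℂ)
    (x : (universeOf hHD hI hU h₃).Coh Y k) :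
    (universeOf hHD hI hU h₃).pullC f k (z ⊗ₜ[ℚ] x) = z ⊗ₜ[ℚ] (universeOf hHD hI hU h₃).pull f k x := by
  show ((universeOf hHD hI hU h₃).pull f k).baseChange ℂ (z ⊗ₜ[ℚ] x) = _
  rw [LinearMap.baseChange_tmul]

/-- **`resQ ∘ restrictQ = levelCover^* ∘ resQ`** (the rational form of `res_restrictLevel`): on the identity component the rational change of
level is the rational pull-back along the level covering `X_{Γ'} ⟶ X_Γ`. [folklore] -/
theorem resQ_restrictQ {Γ Γ' : Level V} (hle : Γ' ≤ Γ) (hΓ : Γ.BelowConjThree) (hΓ' : Γ'.BelowConjThree)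
    (c : levelQ hHD hI hU h₃ hA Γ hΓ) :
    resQ hHD hI hU h₃ hA Γ' hΓ' (restrictQ hHD hI hU h₃ hA hle hΓ hΓ' c) =
      (universeOf hHD hI hU h₃).pull (X := (universeOf hHD hI hU h₃).pms L ι₁ V Γ')
        (Y := (universeOf hHD hI hU h₃).pms L ι₁ V Γ) (levelCover hU h₃ hHD hA Γ Γ' (Level.Γ_mono hle)) 1
        (resQ hHD hI hU h₃ hA Γ hΓ c) := by
  apply TensorProduct.one_tmul_injective ℚ ℂ (CohQ hHD hI hU h₃ Γ' 1)
  show (1 : ℂ) ⊗ₜ[ℚ] _ = (1 : ℂ) ⊗ₜ[ℚ] _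
  rw [← res_inclQ, inclQ_restrictQ, res_restrictLevel, res_inclQ, pullC_tmul]

end ResQ

/-! ## §6 The level law (the S3 pin field `tower_eq`) -/

section LevelLaw

/-- **`resTotal Γ (ιT (z ⊗ ofQ Γ c)) = z ⊗ resQ c`** — reading a rational level-`K` family into the tower through `ιT ∘ (ofQ ⊗ ℂ)` and
restricting to the identity component `P_Γ` gives its (complexified) rational identity-component value: the S3 pin law `tower_eq` with
`transK := ιT ∘ (ofQ Γ ⊗ ℂ)`, `XK := ℂ ⊗ U_K`, `albK := refl`, `resX := resQ ⊗ ℂ`. [folklore] -/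
theorem resTotal_ιT_tmul_ofQ (Γ : Level V) (hΓ : Γ.BelowConjThree) (z : ℂ) (c : levelQ hHD hI hU h₃ hA Γ hΓ) :
    resTotal hHD hI hU h₃ hA Γ (ιT hHD hI hU h₃ hA V (z ⊗ₜ[ℚ] ofQ hHD hI hU h₃ hA Γ hΓ c)) =
      z ⊗ₜ[ℚ] resQ hHD hI hU h₃ hA Γ hΓ c := by
  rw [ιT_tmul_ofQ, map_smul, resTotal_ofLevel, res_inclQ, TensorProduct.smul_tmul', smul_eq_mul, mul_one]

/-- The level law for a general element of `ℂ ⊗ U_K`: `resTotal Γ ∘ ιT ∘ (ofQ Γ ⊗ ℂ) = resQ ⊗ ℂ`. [folklore] -/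
theorem resTotal_ιT_lTensor_ofQ (Γ : Level V) (hΓ : Γ.BelowConjThree) (s : ℂ ⊗[ℚ] levelQ hHD hI hU h₃ hA Γ hΓ) :
    resTotal hHD hI hU h₃ hA Γ (ιT hHD hI hU h₃ hA V ((ofQ hHD hI hU h₃ hA Γ hΓ).lTensor ℂ s)) =
      (resQ hHD hI hU h₃ hA Γ hΓ).baseChange ℂ s := by
  induction s using TensorProduct.induction_on with
  | zero => simp only [map_zero]
  | tmul z c => rw [LinearMap.lTensor_tmul, resTotal_ιT_tmul_ofQ, LinearMap.baseChange_tmul]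
  | add s t hs ht => simp only [map_add, hs, ht]

/-- The level law in the `baseChange` spelling the pin uses (`transK := ιT ∘ₗ (ofQ Γ hΓ).baseChange ℂ`; `LinearMap.baseChange` and
`LinearMap.lTensor` agree as functions, `LinearMap.baseChange_eq_ltensor`). [folklore] -/
theorem resTotal_ιT_baseChange_ofQ (Γ : Level V) (hΓ : Γ.BelowConjThree) (s : ℂ ⊗[ℚ] levelQ hHD hI hU h₃ hA Γ hΓ) :
    resTotal hHD hI hU h₃ hA Γ (ιT hHD hI hU h₃ hA V ((ofQ hHD hI hU h₃ hA Γ hΓ).baseChange ℂ s)) =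
      (resQ hHD hI hU h₃ hA Γ hΓ).baseChange ℂ s := by
  have e : (ofQ hHD hI hU h₃ hA Γ hΓ).baseChange ℂ s = (ofQ hHD hI hU h₃ hA Γ hΓ).lTensor ℂ s :=
    congrFun (LinearMap.baseChange_eq_ltensor (A := ℂ) (f := ofQ hHD hI hU h₃ hA Γ hΓ)) s
  rw [e, resTotal_ιT_lTensor_ofQ]

/-- **The S3 pin field `tower_eq` VERBATIM** for `transK := ιT ∘ₗ (ofQ Γ hΓ).baseChange ℂ`, `jH := LinearMap.id`, `res := resTotal Γ`,
`albK := LinearEquiv.refl`, `resX := (resQ Γ hΓ).baseChange ℂ`: `res (jH (transK c)) = resX (albK c)`. [folklore] -/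
theorem tower_eq_pin (Γ : Level V) (hΓ : Γ.BelowConjThree) (c : ℂ ⊗[ℚ] levelQ hHD hI hU h₃ hA Γ hΓ) :
    resTotal hHD hI hU h₃ hA Γ (LinearMap.id (R := ℂ) ((ιT hHD hI hU h₃ hA V ∘ₗ (ofQ hHD hI hU h₃ hA Γ hΓ).baseChange ℂ) c)) =
      (resQ hHD hI hU h₃ hA Γ hΓ).baseChange ℂ (LinearEquiv.refl ℂ _ c) := by
  rw [LinearMap.id_apply, LinearMap.comp_apply, LinearEquiv.refl_apply, resTotal_ιT_baseChange_ofQ]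

/-- `ιT` on the image of one level, `baseChange` spelling: `ιT ((ofQ Γ ⊗ ℂ) s) = ofLevel Γ (levelι s)`. [folklore] -/
theorem ιT_baseChange_ofQ (Γ : Level V) (hΓ : Γ.BelowConjThree) (s : ℂ ⊗[ℚ] levelQ hHD hI hU h₃ hA Γ hΓ) :
    ιT hHD hI hU h₃ hA V ((ofQ hHD hI hU h₃ hA Γ hΓ).baseChange ℂ s) =
      ofLevel hHD hI hU h₃ hA Γ hΓ (levelι hHD hI hU h₃ hA Γ hΓ s) := by
  have e : (ofQ hHD hI hU h₃ hA Γ hΓ).baseChange ℂ s = (ofQ hHD hI hU h₃ hA Γ hΓ).lTensor ℂ s :=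
    congrFun (LinearMap.baseChange_eq_ltensor (A := ℂ) (f := ofQ hHD hI hU h₃ hA Γ hΓ)) s
  rw [e, ιT_lTensor_ofQ]

/-- **The images of the rational levels consist of `K`-fixed vectors**: `towerRepQ k (ofQ Γ c) = ofQ Γ c` for `k ∈ K` (the rational form
of `act_ofLevel_of_mem`). [folklore] -/
theorem towerRepQ_ofQ_of_mem {Γ : Level V} (hΓ : Γ.BelowConjThree) {k : V.adelicFin} (hk : k ∈ Γ.K)
    (c : levelQ hHD hI hU h₃ hA Γ hΓ) :
    towerRepQ hHD hI hU h₃ hA V k (ofQ hHD hI hU h₃ hA Γ hΓ c) = ofQ hHD hI hU h₃ hA Γ hΓ c := by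
  apply jQ_injective hHD hI hU h₃ hA
  rw [towerRepQ_apply, jQ_actQ, jQ_ofQ, act_ofLevel_of_mem hHD hI hU h₃ hA hΓ hk]

end LevelLaw

end TowerRational

end Summit.HodgeConjecture.CorCM.D2Bridge

end
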